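import Literature.AlgebraicGeometry.Modules.SkyscraperModule
import Literature.AlgebraicGeometry.KTheory.PullbackVectorBundle
import Mathlib.AlgebraicGeometry.Morphisms.Flat
import Mathlib.Algebra.Category.ModuleCat.ChangeOfRings
import Mathlib.CategoryTheory.Adjunction.Unique
import Mathlib.RingTheory.Flat.Basic
import HarnessLib

/-!
# The stalks of an inverse image: `(f^*N)_x ≅ 𝒪_{X,x} ⊗_{𝒪_{Y,f x}} N_{f x}`; flat pull-back preserves monomorphisms

Görtz–Wedhorn, *Algebraic Geometry I* (2nd ed.), (7.8.6): for a morphism of ringed spaces `f : X → Y`,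
an `𝒪_Y`-module `𝒢` and `x ∈ X` there is "a functorial isomorphism of `𝒪_{X,x}`-modules
`(f^*𝒢)_x ≅ 𝒪_{X,x} ⊗_{𝒪_{Y,f(x)}} 𝒢_{f(x)}`"; hence (Remark 7.9 / (7.18), (7.18.1) with `𝓕 = 𝒪_X`)
**for `f` FLAT the functor `f^*` is exact on ALL `𝒪_Y`-modules**, i.e. (it is a left adjoint) it
PRESERVES MONOMORPHISMS.

Mathlib's `Scheme.Modules.pullback f` is the abstract left adjoint of `pushforward f`
(`SheafOfModules.pullback = (pushforward _).leftAdjoint`), with no sections or stalk formula. We obtain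
(7.8.6) by UNIQUENESS OF LEFT ADJOINTS: with the skyscraper `𝒪_X`-modules and the adjunction
`stalk ⊣ skyscraper` of `Modules/SkyscraperModule`,
* `f^*` followed by the stalk at `x` is left adjoint to `f_* ∘ i_{x,*}`
  (`pullbackPushforwardAdjunction`, `stalkSkyscraperAdjunction`),
* the stalk at `f x` followed by `𝒪_{X,x} ⊗_{𝒪_{Y,f x}} –` is left adjoint to
  `i_{f x,*} ∘ (restriction of scalars along f_x♯ : 𝒪_{Y,f x} → 𝒪_{X,x})`
  (`stalkSkyscraperAdjunction`, Mathlib `ModuleCat.extendRestrictScalarsAdj`),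
* and `f_*(i_{x,*}A) ≅ i_{f x,*}(A|_{f_x♯})` (`pushforwardSkyscraperIso`: both have sections
  `(f x ∈ V) → A`, the two `Γ(V, 𝒪_Y)`-actions agree by `f_x♯ ∘ germ_{f x} = germ_x ∘ f♯`, Mathlib
  `Scheme.Hom.germ_stalkMap`),
so `stalkPullbackIso f x : pullback f ⋙ stalkFunctor x ≅ stalkFunctor (f x) ⋙ extendScalars (f.stalkMap x)`
(`Adjunction.leftAdjointUniq`). For `f` flat the stalk maps `f_x♯` are flat (Mathlib `Flat.stalkMap`), so
`𝒪_{X,x} ⊗ –` preserves injective maps (`Module.Flat.lTensor_preserves_injective_linearMap`), the stalks of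
a monomorphism are injective, and monomorphisms of `𝒪_X`-modules are detected on stalks (Mathlib
`TopCat.Presheaf.app_injective_of_stalkFunctor_map_injective`): **`preservesMonomorphisms_pullback_of_flat`**.

* `pushforwardSkyscraperIso`, `pushforwardSkyscraperNatIso`;
* `stalkPullbackAdjunction`, `stalkExtendScalarsAdjunction`, **`stalkPullbackIso`** (GW I (7.8.6));
* `stalkFunctor_map_injective_of_mono`, `mono_of_stalkFunctor_map_injective` (monos of `𝒪_X`-modules are
  the stalkwise injective maps);
* **`preservesMonomorphisms_pullback_of_flat [Flat f] : (Scheme.Modules.pullback f).PreservesMonomorphisms`**,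
  `mono_pullback_map_of_flat'` (any `𝒪_Y`-modules; the quasi-coherent case with its chart proof is
  `Modules/PullbackFlatMono.mono_pullback_map_of_flat`), `preservesFiniteLimits_pullback_of_flat`,
  `shortExact_map_pullback_of_flat'`, `preservesHomology_pullback_of_flat`, `exact_map_pullback_of_flat`
  (**flat pull-back is an exact functor on `𝒪`-modules**).

Everything is proved; no named facts. Written for the cell `pub-hodge-ring2` (route №4, crux
stmt-HodgeConjecture-26512, node «IsogenyDerivedAdjointPair», route K file (3)'s displayed hypothesis
«flat pull-back preserves monomorphisms»; seat core-w2).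

## References

* U. Görtz, T. Wedhorn, *Algebraic Geometry I: Schemes*, 2nd ed. (2020), §(7.8), (7.8.6), Remark 7.9,
  Prop. 7.11, §(7.18) (7.18.1) — read in the held copy `book:gortz2020-algebraic-geometry-i-schemes-2nd-ed`
  (text chunks p0221–p0223, p0240–p0241). [GortzWedhorn2020]
* R. Hartshorne, *Algebraic Geometry* (1977), II §5 p. 110 (`f^*`, `f_*`), III §9 p. 254 (flatness via
  stalks). [Hartshorne1977]
-/

noncomputable section

-- `TopCat.Presheaf`/`Scheme.Modules` are not reducible (as in Mathlib's `AlgebraicGeometry/Modules`).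
set_option backward.isDefEq.respectTransparency false

open CategoryTheory CategoryTheory.Limits AlgebraicGeometry TopologicalSpace Opposite

universe u

namespace Literature.AlgebraicGeometry.Modules

open Literature.AlgebraicGeometry.KTheory

variable {X Y : Scheme.{u}} (f : X ⟶ Y) (x : X)

/-! ### `f_*(i_{x,*}A) ≅ i_{f x,*}(A|_{f_x♯})` -/

section PushforwardSkyscraper

variable (A : ModuleCat.{u} (X.presheaf.stalk x))

/-- The `𝒪_{Y,f x}`-module `A|_{f_x♯}` (restriction of scalars along the stalk map). [folklore] -/
abbrev restrictStalk : ModuleCat.{u} (Y.presheaf.stalk (f x)) :=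
  (ModuleCat.restrictScalars (f.stalkMap x).hom).obj A

/-- On sections over `V`: `Γ(V, f_*(i_{x,*}A)) = (PLift (x ∈ f⁻¹V) → A) → (PLift (f x ∈ V) → A)`, the identity.
[cite: GortzWedhorn2020, (7.8) with Exercise 2.14] -/
def pushforwardSkyscraperHomApp (V : Y.Opens) :
    Γ((Scheme.Modules.pushforward f).obj (skyscraper x A), V) ⟶
      Γ(skyscraper (f x) (restrictStalk f x A), V) :=
  AddCommGrpCat.ofHom
    { toFun := fun (s : SkySections x A (f ⁻¹ᵁ V)) => fun (p : PLift (f x ∈ V)) => s ⟨p.down⟩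
      map_zero' := rfl
      map_add' := fun _ _ => rfl }

/-- The inverse on sections. [cite: GortzWedhorn2020, (7.8) with Exercise 2.14] -/
def pushforwardSkyscraperInvApp (V : Y.Opens) :
    Γ(skyscraper (f x) (restrictStalk f x A), V) ⟶
      Γ((Scheme.Modules.pushforward f).obj (skyscraper x A), V) :=
  AddCommGrpCat.ofHom
    { toFun := fun (s : SkySections (f x) (restrictStalk f x A) V) => fun (p : PLift (x ∈ f ⁻¹ᵁ V)) => s ⟨p.down⟩
      map_zero' := rfl
      map_add' := fun _ _ => rfl }

/-- The scalar action on the sections of `f_*(i_{x,*}A)` over `V`: `r • s = f♯(r) • s`. [folklore] -/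
private theorem pushforward_sky_smul_apply (V : Y.Opens) (r : Γ(Y, V))
    (s : Γ((Scheme.Modules.pushforward f).obj (skyscraper x A), V)) (p : PLift (x ∈ f ⁻¹ᵁ V)) :
    ((r • s : Γ((Scheme.Modules.pushforward f).obj (skyscraper x A), V)) : SkySections x A (f ⁻¹ᵁ V)) p =
      X.presheaf.germ (f ⁻¹ᵁ V) x p.down (f.app V r) • (s : SkySections x A (f ⁻¹ᵁ V)) p :=
  rfl

/-- **`f_*(i_{x,*}A) ≅ i_{f x,*}(A|_{f_x♯})`**: same sections, and the two `Γ(V, 𝒪_Y)`-actions agree because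
`f_x♯(germ_{f x} r) = germ_x(f♯ r)` (Mathlib `Scheme.Hom.germ_stalkMap`).
[cite: GortzWedhorn2020, (7.8) with Exercise 2.14 and (7.8.2)] -/
def pushforwardSkyscraperIso :
    (Scheme.Modules.pushforward f).obj (skyscraper x A) ≅ skyscraper (f x) (restrictStalk f x A) where
  hom := ⟨PresheafOfModules.homMk
    { app := fun V => pushforwardSkyscraperHomApp f x A V.unop
      naturality := fun _ _ _ => rfl }
    (fun V r s => funext fun p => by
      change X.presheaf.germ (f ⁻¹ᵁ V.unop) x p.down (f.app V.unop r) • (s : SkySections x A (f ⁻¹ᵁ V.unop)) ⟨p.down⟩ =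
        (f.stalkMap x) (Y.presheaf.germ V.unop (f x) p.down r) • (s : SkySections x A (f ⁻¹ᵁ V.unop)) ⟨p.down⟩
      rw [Scheme.Hom.germ_stalkMap_apply])⟩
  inv := ⟨PresheafOfModules.homMk
    { app := fun V => pushforwardSkyscraperInvApp f x A V.unop
      naturality := fun _ _ _ => rfl }
    (fun V r s => funext fun p => by
      change (f.stalkMap x) (Y.presheaf.germ V.unop (f x) p.down r) •
          (s : SkySections (f x) (restrictStalk f x A) V.unop) ⟨p.down⟩ =
        X.presheaf.germ (f ⁻¹ᵁ V.unop) x p.down (f.app V.unop r) •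
          (s : SkySections (f x) (restrictStalk f x A) V.unop) ⟨p.down⟩
      rw [Scheme.Hom.germ_stalkMap_apply])⟩
  hom_inv_id := by
    refine Scheme.Modules.hom_ext _ _ fun V => ?_
    ext s
    rfl
  inv_hom_id := by
    refine Scheme.Modules.hom_ext _ _ fun V => ?_
    ext s
    rfl

/-- `pushforwardSkyscraperIso` on sections. [cite: GortzWedhorn2020, (7.8) with Exercise 2.14 and (7.8.2)] -/
theorem pushforwardSkyscraperIso_hom_app_apply (V : Y.Opens)
    (s : Γ((Scheme.Modules.pushforward f).obj (skyscraper x A), V)) (p : PLift (f x ∈ V)) :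
    ((pushforwardSkyscraperIso f x A).hom.app V s : SkySections (f x) (restrictStalk f x A) V) p =
      (s : SkySections x A (f ⁻¹ᵁ V)) ⟨p.down⟩ :=
  rfl

end PushforwardSkyscraper

/-- **`f_* ∘ i_{x,*} ≅ i_{f x,*} ∘ (–)|_{f_x♯}`** as functors `ModuleCat 𝒪_{X,x} ⥤ Y.Modules`.
[cite: GortzWedhorn2020, (7.8) with Exercise 2.14 and (7.8.2)] -/
def pushforwardSkyscraperNatIso :
    skyscraperFunctor x ⋙ Scheme.Modules.pushforward f ≅
      ModuleCat.restrictScalars.{u} (f.stalkMap x).hom ⋙ skyscraperFunctor (f x) :=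
  NatIso.ofComponents (fun A => pushforwardSkyscraperIso f x A) (fun {A B} a => by
    refine Scheme.Modules.hom_ext _ _ fun V => ?_
    ext s
    rfl)

/-! ### The stalk formula `(f^*N)_x ≅ 𝒪_{X,x} ⊗_{𝒪_{Y,f x}} N_{f x}` by uniqueness of left adjoints -/

/-- `f^*` followed by the stalk at `x` is left adjoint to `f_* ∘ i_{x,*}`. [cite: GortzWedhorn2020, Prop. 7.11] -/
def stalkPullbackAdjunction :
    Scheme.Modules.pullback f ⋙ stalkFunctor x ⊣ skyscraperFunctor x ⋙ Scheme.Modules.pushforward f :=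
  (Scheme.Modules.pullbackPushforwardAdjunction f).comp (stalkSkyscraperAdjunction x)

/-- The stalk at `f x` followed by `𝒪_{X,x} ⊗_{𝒪_{Y,f x}} –` is left adjoint to `i_{f x,*} ∘ (–)|_{f_x♯}`.
[cite: GortzWedhorn2020, Prop. 7.11] -/
def stalkExtendScalarsAdjunction :
    stalkFunctor (f x) ⋙ ModuleCat.extendScalars.{u, u, u} (f.stalkMap x).hom ⊣
      ModuleCat.restrictScalars.{u} (f.stalkMap x).hom ⋙ skyscraperFunctor (f x) :=
  (stalkSkyscraperAdjunction (f x)).comp (ModuleCat.extendRestrictScalarsAdj.{u, u, u} (f.stalkMap x).hom)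

/-- **The stalk formula (GW I (7.8.6)): `(f^*N)_x ≅ 𝒪_{X,x} ⊗_{𝒪_{Y,f x}} N_{f x}`, naturally in `N`** — as an
isomorphism of functors `pullback f ⋙ stalkFunctor x ≅ stalkFunctor (f x) ⋙ extendScalars (f_x♯)`, by
uniqueness of left adjoints. [cite: GortzWedhorn2020, (7.8.6)] -/
def stalkPullbackIso :
    Scheme.Modules.pullback f ⋙ stalkFunctor x ≅
      stalkFunctor (f x) ⋙ ModuleCat.extendScalars.{u, u, u} (f.stalkMap x).hom :=
  ((stalkPullbackAdjunction f x).ofNatIsoRight (pushforwardSkyscraperNatIso f x)).leftAdjointUniq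
    (stalkExtendScalarsAdjunction f x)

/-! ### Monomorphisms of `𝒪_X`-modules are detected on stalks -/

/-- The stalk maps of a monomorphism of `𝒪_X`-modules are injective. [cite: GortzWedhorn2020, (7.8.6) and Remark 7.9] -/
theorem stalkFunctor_map_injective_of_mono {M N : X.Modules} (φ : M ⟶ N) [Mono φ] (x : X) :
    Function.Injective ((stalkFunctor x).map φ) :=
  TopCat.Presheaf.stalkFunctor_map_injective_of_app_injective
    (f := φ.mapPresheaf) (fun U => app_injective_of_mono φ U) x

/-- A morphism of `𝒪_X`-modules with injective stalk maps is a monomorphism.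
[cite: GortzWedhorn2020, (7.8.6) and Remark 7.9] -/
theorem mono_of_stalkFunctor_map_injective {M N : X.Modules} (φ : M ⟶ N)
    (h : ∀ x : X, Function.Injective ((stalkFunctor x).map φ)) : Mono φ :=
  mono_of_app_injective φ fun U =>
    TopCat.Presheaf.app_injective_of_stalkFunctor_map_injective (F := ⟨M.presheaf, M.isSheaf⟩)
      φ.mapPresheaf U fun x _ => h x

/-! ### Flat pull-back preserves monomorphisms -/

/-- For `f` flat and `ι : N' ↪ N` a monomorphism of `𝒪_Y`-modules, the stalk map of `f^*ι` at `x` is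
injective: under `stalkPullbackIso` it is `𝒪_{X,x} ⊗_{𝒪_{Y,f x}} ι_{f x}`, injective because `ι_{f x}` is and
`𝒪_{X,x}` is flat over `𝒪_{Y,f x}`. [cite: GortzWedhorn2020, (7.8.6) and (7.18.1)] -/
theorem stalkFunctor_map_pullback_map_injective [Flat f] {N' N : Y.Modules} (ι : N' ⟶ N) [Mono ι] :
    Function.Injective ((stalkFunctor x).map ((Scheme.Modules.pullback f).map ι)) := by
  -- transport along the natural isomorphism `stalkPullbackIso`
  let e := stalkPullbackIso f x
  have hnat : (stalkFunctor x).map ((Scheme.Modules.pullback f).map ι) =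
      e.hom.app N' ≫ (ModuleCat.extendScalars.{u, u, u} (f.stalkMap x).hom).map ((stalkFunctor (f x)).map ι) ≫
        e.inv.app N := by
    have h := e.hom.naturality ι
    calc (stalkFunctor x).map ((Scheme.Modules.pullback f).map ι)
        = ((Scheme.Modules.pullback f ⋙ stalkFunctor x).map ι ≫ e.hom.app N) ≫ e.inv.app N := by
          rw [Category.assoc, Iso.hom_inv_id_app, Category.comp_id]; rfl
      _ = (e.hom.app N' ≫ (stalkFunctor (f x) ⋙ ModuleCat.extendScalars.{u, u, u} (f.stalkMap x).hom).map ι) ≫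
            e.inv.app N := by rw [h]
      _ = _ := by rw [Category.assoc]; rfl
  rw [hnat]
  -- the base change of the injective `𝒪_{Y,f x}`-linear stalk map is injective by flatness
  letI : Algebra (Y.presheaf.stalk (f x)) (X.presheaf.stalk x) :=
    ((algebraMap (X.presheaf.stalk x) (X.presheaf.stalk x)).comp (f.stalkMap x).hom).toAlgebra
  haveI : Module.Flat (Y.presheaf.stalk (f x)) (X.presheaf.stalk x) := Flat.stalkMap f x
  have hinj : Function.Injective
      ((ModuleCat.extendScalars.{u, u, u} (f.stalkMap x).hom).map ((stalkFunctor (f x)).map ι)) :=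
    Module.Flat.lTensor_preserves_injective_linearMap (M := ↑(X.presheaf.stalk x))
      ((stalkFunctor (f x)).map ι).hom (stalkFunctor_map_injective_of_mono ι (f x))
  change Function.Injective ((e.hom.app N' ≫ (ModuleCat.extendScalars.{u, u, u} (f.stalkMap x).hom).map
    ((stalkFunctor (f x)).map ι) ≫ e.inv.app N).hom)
  rw [ModuleCat.hom_comp, ModuleCat.hom_comp, LinearMap.coe_comp, LinearMap.coe_comp]
  exact ((ModuleCat.mono_iff_injective _).mp inferInstance).comp
    (hinj.comp ((ModuleCat.mono_iff_injective _).mp inferInstance))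

/-- **Flat pull-back preserves monomorphisms of `𝒪`-modules**: for a flat morphism of schemes `f : X → Y`,
`f^* = Scheme.Modules.pullback f` carries monomorphisms of `𝒪_Y`-modules to monomorphisms (so, being a left
adjoint, it is exact). [cite: GortzWedhorn2020, (7.18.1) with (7.8.6)] [cite: Hartshorne1977, III §9 p. 254] -/
theorem preservesMonomorphisms_pullback_of_flat [Flat f] : (Scheme.Modules.pullback f).PreservesMonomorphisms where
  preserves ι _ := mono_of_stalkFunctor_map_injective _ fun x => stalkFunctor_map_pullback_map_injective f x ι

/-- Flat pull-back of a monomorphism of arbitrary `𝒪_Y`-modules is a monomorphism.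
[cite: GortzWedhorn2020, (7.18.1) with (7.8.6)] -/
theorem mono_pullback_map_of_flat' [Flat f] {N' N : Y.Modules} (ι : N' ⟶ N) [Mono ι] :
    Mono ((Scheme.Modules.pullback f).map ι) :=
  (preservesMonomorphisms_pullback_of_flat f).preserves ι

/-- **Flat pull-back is left exact** (hence exact, `f^*` being right exact as a left adjoint): `f^*`
preserves finite limits. [cite: GortzWedhorn2020, (7.18.1) with (7.8.6)] -/
theorem preservesFiniteLimits_pullback_of_flat [Flat f] : PreservesFiniteLimits (Scheme.Modules.pullback f) :=
  (Functor.preservesFiniteLimits_iff_forall_exact_map_and_mono _).mpr fun S hS =>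
    haveI := hS.mono_f
    ⟨(exact_map_pullback_and_epi f hS).1, mono_pullback_map_of_flat' f S.f⟩

/-- **Flat pull-back is exact**: it carries short exact sequences of `𝒪_Y`-modules to short exact
sequences. [cite: GortzWedhorn2020, (7.18.1) with (7.8.6)] [cite: Hartshorne1977, III §9 p. 254] -/
theorem shortExact_map_pullback_of_flat' [Flat f] {S : ShortComplex Y.Modules} (hS : S.ShortExact) :
    (S.map (Scheme.Modules.pullback f)).ShortExact :=
  haveI := preservesFiniteLimits_pullback_of_flat f
  hS.map_of_exact (Scheme.Modules.pullback f)

/-- **Flat pull-back is exact**: it preserves homology (kernels, cokernels, exactness of any short complex).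
[cite: GortzWedhorn2020, (7.18.1) with (7.8.6)] -/
theorem preservesHomology_pullback_of_flat [Flat f] : (Scheme.Modules.pullback f).PreservesHomology :=
  haveI := preservesFiniteLimits_pullback_of_flat f
  inferInstance

/-- For `f` flat and an exact short complex `S` of `𝒪_Y`-modules, `f^*S` is exact.
[cite: GortzWedhorn2020, (7.18.1) with (7.8.6)] -/
theorem exact_map_pullback_of_flat [Flat f] {S : ShortComplex Y.Modules} (hS : S.Exact) :
    (S.map (Scheme.Modules.pullback f)).Exact :=
  haveI := preservesHomology_pullback_of_flat f
  hS.map (Scheme.Modules.pullback f)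

end Literature.AlgebraicGeometry.Modules

end
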